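import Summits.BirchSwinnertonDyer.Rank1Residual.X11b.BDPRouteLocalKernelInertia
import HarnessLib

/-!
# Class X11b, route p2: Greenberg's Lemma 3.3 through the inertia group — the Tamagawa algebra
# `#ker r_v ≤ p ^ ord_p [E(K̄)^{D_v} : E(K̄)^{D_v} ⊓ M₀]` for `M₀ ≤ E(K̄)^{I_v}`, and surjectivity of
# `φ − 1` on `M₀[p^∞]` from divisibility (cell `b2b-bsdres`, sub-cell `multr1-p2`, gen 14)

HONEST FRAMING (verbatim, cell `b2b-bsdres`): the goal of the cell is to DELETE the
COMBINATION-SHAPED residual classes for ALL analytic-rank `≤ 1` curves over `ℚ` — "full BSD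
formula for every rank `≤ 1` curve in class `C`" assembled STRICTLY from published theorems — so
that the rank-`≤ 1` remainder becomes exactly the CONSTRUCTION-SHAPED classes, which are TYPED
(missing-input Props), NOT attempted; this is not "finishing BSD". Research route `p2` for class
X11b; no claim beyond the stated class; nothing booked; X11b stays CONSTRUCTION-SHAPED. Theorems
only; no definition, no named fact, no `sorry`. Continues `BDPRouteLocalKernelInertia.lean`
(`ker r_v ⊆ ker (H¹(D_v, M) → H¹(I_v, M)) ↪ M^{I_v}/(φ − 1)M^{I_v}`, `inertiaSubOne`,
`inertiaSubOne_eq_zero_iff`, `fixedPrimaryEquivInertia`).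

## Content (Greenberg, LNM 1716, §3 Lemma 3.3 at a bad `v ∤ p`; §4 proof of Thm. 4.1, p. 74)

* **`natCard_localKer_le_pow_padicValNat_relIndex_inertia`** — for `I_v ≤ H` (e.g. `H = ker κ`), an
  arithmetic Frobenius `φ ∈ D_v` at `𝔓₀`, and a `φ`-stable finite-index `M₀ ≤ M := E(K̄)^{I_v}` such
  that `φ − 1` maps `M[p^∞] ⊓ M₀` onto itself: `#ker r_v ≤ p ^ ord_p [ker(φ−1) : ker(φ−1) ⊓ M₀]`
  (gen 13's `TamagawaCoinvariants.natCard_primaryComponent_quotient_range_le` on `M^{I_v}`).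
* **`natCard_localKer_le_pow_padicValNat_relIndex_of_divisible`** — the surjectivity hypothesis
  replaced by: `M₀[p^∞]` is `p`-divisible and the `D_v`-fixed `p`-power torsion of `E(K̄)` is finite
  (tree `PrimaryGroup.le_range_of_finite_ker`: a finite-kernel endomorphism of a divisible
  `p`-primary group with finite `p`-torsion is onto).
* **`natCard_localKer_kerSubgroup_le_of_divisible`** — the case `H = ker κ` of a `ℤ_p`-extension at
  `v ∤ p` (`I_v ≤ ker κ`, tree `ZpExtension.inertia_le_kerSubgroup_holds`).

Intended `M₀ = E₀(K_v^{nr})^{alg}` (points of non-singular reduction on the minimal model at `v`):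
`φ`-stable, of finite index (Kodaira–Néron over `K_v^{nr}`), `M₀[p^∞] ≅ Ẽ_ns(k̄_v)[p^∞]` divisible,
`[E(K̄)^{D_v} : E(K̄)^{D_v} ⊓ M₀] ∣ [E(K_v) : E₀(K_v)] = c_v` — the business of the companion file
`BDPRouteNonsingularPart.lean`. CONDITIONAL use only (input (c) of route p2's (CTL≤)ᵗ,
`BDPRouteControlBadPlaces`); nothing booked; reach and labels unchanged.

References: [GreenbergLNM1716] §3 Lemma 3.3 and its proof (p. 87), Lemma 3.1 (p. 86), §4 proof of
Thm. 4.1 (p. 74); [SilvermanAEC2009] §VII.6 (`E₀`, `c_v`).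
-/

noncomputable section

open scoped Classical Pointwise

open NumberField IsDedekindDomain Field
open Literature.NumberTheory.EllipticCurves Literature.NumberTheory.EllipticCurves.GreenbergSelmer
open Literature.NumberTheory.GaloisRepresentations Literature.NumberTheory.EllipticCurves.ResKernel

universe u

namespace Summit.BirchSwinnertonDyer.Rank1Residual.X11b.AcSelmer

section Curve

variable {K : Type u} [Field K] [NumberField K] (W : WeierstrassCurve K) {p : ℕ} [Fact p.Prime]
  {v : HeightOneSpectrum (𝓞 K)}

/-- **Greenberg's Lemma 3.3 at a bad place through the inertia group — the Tamagawa algebra.** For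
an elliptic curve `E` over a number field `K`, a prime `p`, a finite place `v`, a subgroup
`H ≥ I_v` of `Γ_K` (intended `H = Gal(K̄/K_∞)` for a `ℤ_p`-extension, unramified at `v ∤ p`) and an
arithmetic Frobenius `φ` at the chosen `𝔓₀ ∣ v`: let `M = E(K̄)^{I_v}` and `ψ = φ − 1` on `M`
(`inertiaSubOne`). For every `ψ`-stable subgroup `M₀ ≤ M` of finite index such that `ψ` maps
`M[p^∞] ⊓ M₀` onto itself, the local kernel
`ker r_v = localKer H E[p^∞] v = ker (H¹(D_v, E[p^∞]) → H¹(H ⊓ D_v, E[p^∞]))` is finite and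
`#ker r_v ≤ p ^ ord_p [ker ψ : ker ψ ⊓ M₀]` (`ker ψ = E(K̄)^{D_v}`, `inertiaSubOne_eq_zero_iff`).
Intended `M₀ = E₀(K_v^{nr})^{alg}`, index `[E(K_v) : E₀(K_v)] = c_v` ("`#ker r_v ≤ c_v^{(p)}`").
[cite: GreenbergLNM1716, §3 Lemma 3.3 (p. 87) and §4 proof of Thm. 4.1 (p. 74)] -/
theorem natCard_localKer_le_pow_padicValNat_relIndex_inertia
    {H : Subgroup (absoluteGaloisGroup K)}
    (hIH : (adicCompletionPrime K v).inertia (absoluteGaloisGroup K) ≤ H)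
    {φ : absoluteGaloisGroup K} (hφ : IsArithFrobAt (𝓞 K) φ (adicCompletionPrime K v))
    (hφD : φ ∈ decomp v)
    (M₀ : AddSubgroup ↥(FixedPoints.addSubgroup
      ↥((adicCompletionPrime K v).inertia (absoluteGaloisGroup K)) W.geomPoints))
    [M₀.FiniteIndex]
    (hM₀ : ∀ x ∈ M₀, inertiaSubOne W.geomPoints φ hφD x ∈ M₀)
    (hsurj : ∀ b ∈ AddCommGroup.primaryComponent
        ↥(FixedPoints.addSubgroup ↥((adicCompletionPrime K v).inertia (absoluteGaloisGroup K))
          W.geomPoints) p, b ∈ M₀ →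
      ∃ b' ∈ AddCommGroup.primaryComponent
          ↥(FixedPoints.addSubgroup ↥((adicCompletionPrime K v).inertia (absoluteGaloisGroup K))
            W.geomPoints) p,
        b' ∈ M₀ ∧ inertiaSubOne W.geomPoints φ hφD b' = b) :
    Finite (localKer H (W.geomPrimaryTorsion p) v) ∧
      Nat.card (localKer H (W.geomPrimaryTorsion p) v) ≤
        p ^ padicValNat p (M₀.relIndex (inertiaSubOne W.geomPoints φ hφD).ker) := by
  -- notation: `M = E(K̄)^{I_v}`, `ψ = φ − 1`, `B = M[p^∞]`, `fB = ψ|_B`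
  set ψ := inertiaSubOne W.geomPoints φ hφD with hψ
  let B := AddCommGroup.primaryComponent
    ↥(FixedPoints.addSubgroup ↥((adicCompletionPrime K v).inertia (absoluteGaloisGroup K))
      W.geomPoints) p
  let fB : B →+ B := (ψ.comp B.subtype).codRestrict B
    fun b ↦ PrimaryCoinvariants.map_mem_primaryComponent p ψ b.2
  have hfB : ∀ b : B, (fB b : FixedPoints.addSubgroup
      ↥((adicCompletionPrime K v).inertia (absoluteGaloisGroup K)) W.geomPoints) = ψ b :=
    fun _ ↦ rfl
  -- (1) the algebra: `#B/ψ(B) ≤ p ^ ord_p [ker ψ : ker ψ ⊓ M₀]`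
  obtain ⟨hfinQ, hcardQ⟩ :=
    TamagawaCoinvariants.natCard_primaryComponent_quotient_range_le p ψ M₀ hM₀ fB hfB hsurj
  haveI := hfinQ
  -- (2) `E[p^∞]^{I_v}/(φ − 1) ≅ B/ψ(B)` along `fixedPrimaryEquivInertia`
  let e := fixedPrimaryEquivInertia W (p := p) (v := v)
  have he : AddSubgroup.map e.toAddMonoidHom
      (inertiaSubOne (W.geomPrimaryTorsion p) φ hφD).range = fB.range := by
    ext b
    constructor
    · rintro ⟨x, ⟨y, rfl⟩, rfl⟩
      exact ⟨e y, Subtype.ext (Subtype.ext rfl)⟩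
    · rintro ⟨y, rfl⟩
      exact ⟨inertiaSubOne (W.geomPrimaryTorsion p) φ hφD (e.symm y), ⟨e.symm y, rfl⟩,
        Subtype.ext (Subtype.ext rfl)⟩
  let eq : FixedPoints.addSubgroup ↥((adicCompletionPrime K v).inertia (absoluteGaloisGroup K))
      (W.geomPrimaryTorsion p) ⧸ (inertiaSubOne (W.geomPrimaryTorsion p) φ hφD).range ≃+
        B ⧸ fB.range :=
    QuotientAddGroup.congr _ _ e he
  haveI hfin1 : Finite (FixedPoints.addSubgroup
      ↥((adicCompletionPrime K v).inertia (absoluteGaloisGroup K)) (W.geomPrimaryTorsion p) ⧸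
        (inertiaSubOne (W.geomPrimaryTorsion p) φ hφD).range) :=
    Finite.of_equiv _ eq.toEquiv.symm
  have hcard : Nat.card (FixedPoints.addSubgroup
      ↥((adicCompletionPrime K v).inertia (absoluteGaloisGroup K)) (W.geomPrimaryTorsion p) ⧸
        (inertiaSubOne (W.geomPrimaryTorsion p) φ hφD).range) = Nat.card (B ⧸ fB.range) :=
    Nat.card_congr eq.toEquiv
  -- (3) `ker r_v ↪ E[p^∞]^{I_v}/(φ − 1)`
  have hφD0 : φ ∈ decomp v :=
    (decomp_eq_decompositionSubgroup_adicCompletionPrime v).symm ▸ hφ.mem_stabilizer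
  have eψ : inertiaSubOne (W.geomPrimaryTorsion p) φ hφD0 =
      inertiaSubOne (W.geomPrimaryTorsion p) φ hφD := rfl
  haveI : Finite (FixedPoints.addSubgroup
      ↥((adicCompletionPrime K v).inertia (absoluteGaloisGroup K)) (W.geomPrimaryTorsion p) ⧸
        (inertiaSubOne (W.geomPrimaryTorsion p) φ hφD0).range) := by rw [eψ]; exact hfin1
  obtain ⟨hfin, hle⟩ := finite_localKer_and_natCard_le_inertia (W.geomPrimaryTorsion p) hIH
    (W.continuous_smul_geomPrimaryTorsion p) hφ
  rw [eψ] at hle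
  exact ⟨hfin, hle.trans (hcard.le.trans hcardQ)⟩

/-- **The same with DIVISIBILITY in place of surjectivity.** If `M₀[p^∞] = M[p^∞] ⊓ M₀` is
`p`-divisible and the `D_v`-fixed `p`-power torsion points of `E(K̄)` form a finite set (the
`K_v`-rational `p`-power torsion), then `φ − 1` — an endomorphism of the `p`-primary group `M₀[p^∞]`
(`M₀[p] ⊆ E[p]` finite) whose kernel lies in that finite set — is onto `M₀[p^∞]`
(tree `PrimaryGroup.le_range_of_finite_ker`: "`B_div ⊆ (γ − 1)B`"), and the previous bound applies:
`#ker r_v ≤ p ^ ord_p [E(K̄)^{D_v} ∩ M : … ⊓ M₀]`. Intended `M₀ = E₀(K_v^{nr})^{alg}` with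
`M₀[p^∞] ≅ Ẽ_ns(k̄_v)[p^∞]` divisible. [cite: GreenbergLNM1716, §3 Lemma 3.3 (p. 87), Lemma 3.1 (p. 86)] -/
theorem natCard_localKer_le_pow_padicValNat_relIndex_of_divisible [W.IsElliptic]
    {H : Subgroup (absoluteGaloisGroup K)}
    (hIH : (adicCompletionPrime K v).inertia (absoluteGaloisGroup K) ≤ H)
    {φ : absoluteGaloisGroup K} (hφ : IsArithFrobAt (𝓞 K) φ (adicCompletionPrime K v))
    (hφD : φ ∈ decomp v)
    (M₀ : AddSubgroup ↥(FixedPoints.addSubgroup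
      ↥((adicCompletionPrime K v).inertia (absoluteGaloisGroup K)) W.geomPoints))
    [M₀.FiniteIndex]
    (hM₀ : ∀ x ∈ M₀, inertiaSubOne W.geomPoints φ hφD x ∈ M₀)
    (hdiv : ∀ b ∈ AddCommGroup.primaryComponent
        ↥(FixedPoints.addSubgroup ↥((adicCompletionPrime K v).inertia (absoluteGaloisGroup K))
          W.geomPoints) p, b ∈ M₀ →
      ∃ b' ∈ AddCommGroup.primaryComponent
          ↥(FixedPoints.addSubgroup ↥((adicCompletionPrime K v).inertia (absoluteGaloisGroup K))
            W.geomPoints) p, b' ∈ M₀ ∧ p • b' = b)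
    (hfin : Set.Finite {m : W.geomPoints |
      (∀ x ∈ decomp v, x • m = m) ∧ ∃ k : ℕ, p ^ k • m = 0}) :
    Finite (localKer H (W.geomPrimaryTorsion p) v) ∧
      Nat.card (localKer H (W.geomPrimaryTorsion p) v) ≤
        p ^ padicValNat p (M₀.relIndex (inertiaSubOne W.geomPoints φ hφD).ker) := by
  have hp : p.Prime := Fact.out
  -- notation
  set ψ := inertiaSubOne W.geomPoints φ hφD with hψ
  let Mfix := FixedPoints.addSubgroup
    ↥((adicCompletionPrime K v).inertia (absoluteGaloisGroup K)) W.geomPoints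
  let B : AddSubgroup Mfix := AddCommGroup.primaryComponent Mfix p
  -- `B₀ = B ⊓ M₀`, a `ψ`-stable subgroup
  let B₀ : AddSubgroup Mfix := B ⊓ M₀
  have hB₀ψ : ∀ x ∈ B₀, ψ x ∈ B₀ := fun x hx ↦
    ⟨PrimaryCoinvariants.map_mem_primaryComponent p ψ hx.1, hM₀ x hx.2⟩
  let ψ₀ : B₀ →+ B₀ := (ψ.comp B₀.subtype).codRestrict B₀ fun b ↦ hB₀ψ b b.2
  have hψ₀ : ∀ b : B₀, ((ψ₀ b : B₀) : Mfix) = ψ b := fun _ ↦ rfl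
  -- `B₀` is `p`-primary with `B₀[p]` finite
  have hprim : ∀ b : B₀, ∃ k : ℕ, p ^ k • b = 0 := fun b ↦ by
    obtain ⟨k, hk⟩ := (AddCommGroup.mem_primaryComponent).mp b.2.1
    exact ⟨k, Subtype.ext hk⟩
  haveI : Finite (AddSubgroup.torsionBy (↥B₀) p) := by
    haveI : Finite (W.geomTorsion (p : ℤ)) :=
      W.finite_torsionPoints_holds (AlgebraicClosure K) (by exact_mod_cast hp.ne_zero)
    refine Finite.of_injective (fun x : AddSubgroup.torsionBy (↥B₀) p ↦
      (⟨(((x : B₀) : Mfix) : W.geomPoints), ?_⟩ : W.geomTorsion (p : ℤ))) ?_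
    · have hx := AddSubgroup.torsionBy.nsmul_iff.mp x.2
      have h1 : p • (((x : B₀) : Mfix) : W.geomPoints) = 0 := by
        have := congrArg (fun z : B₀ ↦ ((z : Mfix) : W.geomPoints)) hx
        simpa only [AddSubgroupClass.coe_nsmul, ZeroMemClass.coe_zero] using this
      exact AddSubgroup.torsionBy.nsmul_iff.mpr h1
    · intro a b hab
      apply Subtype.ext; apply Subtype.ext; apply Subtype.ext
      exact congrArg (fun z : W.geomTorsion (p : ℤ) ↦ (z : W.geomPoints)) hab
  -- `p B₀ = B₀`
  have hD : ∀ d ∈ (⊤ : AddSubgroup B₀), ∃ d' ∈ (⊤ : AddSubgroup B₀), p • d' = d := by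
    intro d _
    obtain ⟨b', hb'B, hb'M₀, hb'⟩ := hdiv (d : Mfix) d.2.1 d.2.2
    exact ⟨⟨b', hb'B, hb'M₀⟩, AddSubgroup.mem_top _, Subtype.ext hb'⟩
  -- `ker ψ₀` is finite: it consists of `D_v`-fixed `p`-power torsion points
  haveI : Finite ψ₀.ker := by
    haveI := hfin.to_subtype
    refine Finite.of_injective (fun x : ψ₀.ker ↦ (⟨((((x : B₀) : Mfix)) : W.geomPoints), ?_, ?_⟩ :
      {m : W.geomPoints | (∀ x ∈ decomp v, x • m = m) ∧ ∃ k : ℕ, p ^ k • m = 0})) ?_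
    · have h0 : ψ ((x : B₀) : Mfix) = 0 := by
        have := congrArg (fun z : B₀ ↦ (z : Mfix)) ((AddMonoidHom.mem_ker).mp x.2)
        simpa only [hψ₀, ZeroMemClass.coe_zero] using this
      exact (inertiaSubOne_eq_zero_iff W hφ hφD _).mp h0
    · obtain ⟨k, hk⟩ := hprim (x : B₀)
      refine ⟨k, ?_⟩
      have := congrArg (fun z : B₀ ↦ ((z : Mfix) : W.geomPoints)) hk
      simpa only [AddSubgroupClass.coe_nsmul, ZeroMemClass.coe_zero] using this
    · intro a b hab
      have h := congrArg Subtype.val hab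
      dsimp only at h
      exact Subtype.ext (Subtype.ext (Subtype.ext h))
  -- hence `ψ₀` is onto (`B_div ⊆ ψ(B)` with `B_div = B₀`)
  have honto : (⊤ : AddSubgroup B₀) ≤ ψ₀.range :=
    PrimaryGroup.le_range_of_finite_ker p hprim hD ψ₀ (fun _ _ ↦ AddSubgroup.mem_top _)
  have hsurj : ∀ b ∈ B, b ∈ M₀ → ∃ b' ∈ B, b' ∈ M₀ ∧ ψ b' = b := by
    intro b hbB hbM₀
    obtain ⟨x, hx⟩ := honto (AddSubgroup.mem_top (⟨b, hbB, hbM₀⟩ : B₀))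
    refine ⟨((x : B₀) : Mfix), x.2.1, x.2.2, ?_⟩
    have := congrArg (fun z : B₀ ↦ (z : Mfix)) hx
    simpa only [hψ₀] using this
  exact natCard_localKer_le_pow_padicValNat_relIndex_inertia W hIH hφ hφD M₀ hM₀ hsurj

/-- **For a `ℤ_p`-extension at `v ∤ p`** (`I_v ≤ ker κ`, tree `ZpExtension.inertia_le_kerSubgroup_holds`):
the bound for Greenberg's `ker r_v = localKer (ker κ) E[p^∞] v`, from a `φ`-stable finite-index
`M₀ ≤ E(K̄)^{I_v}` with `p`-divisible `M₀[p^∞]`, the finiteness of the `D_v`-fixed `p`-power torsion,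
and the index `[ker(φ−1) : ker(φ−1) ⊓ M₀]`. [cite: GreenbergLNM1716, §3 Lemma 3.3 (p. 87)]
[cite: Washington1997, Prop. 13.2 (ℤ_p-extensions are unramified outside p)] -/
theorem natCard_localKer_kerSubgroup_le_of_divisible [W.IsElliptic] (κ : ZpExtension K p)
    (hpv : (p : 𝓞 K) ∉ v.asIdeal)
    {φ : absoluteGaloisGroup K} (hφ : IsArithFrobAt (𝓞 K) φ (adicCompletionPrime K v))
    (hφD : φ ∈ decomp v)
    (M₀ : AddSubgroup ↥(FixedPoints.addSubgroup
      ↥((adicCompletionPrime K v).inertia (absoluteGaloisGroup K)) W.geomPoints))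
    [M₀.FiniteIndex]
    (hM₀ : ∀ x ∈ M₀, inertiaSubOne W.geomPoints φ hφD x ∈ M₀)
    (hdiv : ∀ b ∈ AddCommGroup.primaryComponent
        ↥(FixedPoints.addSubgroup ↥((adicCompletionPrime K v).inertia (absoluteGaloisGroup K))
          W.geomPoints) p, b ∈ M₀ →
      ∃ b' ∈ AddCommGroup.primaryComponent
          ↥(FixedPoints.addSubgroup ↥((adicCompletionPrime K v).inertia (absoluteGaloisGroup K))
            W.geomPoints) p, b' ∈ M₀ ∧ p • b' = b)
    (hfin : Set.Finite {m : W.geomPoints |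
      (∀ x ∈ decomp v, x • m = m) ∧ ∃ k : ℕ, p ^ k • m = 0}) :
    Finite (localKer κ.kerSubgroup (W.geomPrimaryTorsion p) v) ∧
      Nat.card (localKer κ.kerSubgroup (W.geomPrimaryTorsion p) v) ≤
        p ^ padicValNat p (M₀.relIndex (inertiaSubOne W.geomPoints φ hφD).ker) :=
  natCard_localKer_le_pow_padicValNat_relIndex_of_divisible W
    (ZpExtension.inertia_le_kerSubgroup_holds K p κ hpv (adicCompletionPrime_mem_primesAbove K v))
    hφ hφD M₀ hM₀ hdiv hfin

end Curve

end Summit.BirchSwinnertonDyer.Rank1Residual.X11b.AcSelmer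

end
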